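import Mathlib
import HarnessLib

/-!
# Crux `NoZenoR` (stmt-ResolutionOfSingularities-19943), slot 5 (B1) upstairs seam (A2):
# «C-curves lie in the chart» — the fibre of the chart resolution over a closed point is closed
# in the ambient resolution (route-independent part: Mathlib only)

OURS (cell res-hironaka, crux chain W4.4, seat res-D-pv-045 gen 8; object (o-A2) of the lead's
B1-CENSUS-g8 §2 (A2), OFFER 2026-08-27T18:40:19Z); nothing here is a statement of the manuscript
under review (Hironaka 2017); AI-written, weaker than expert review.  SUPPORT-level, counted 0.
Def-free, fact-free, imports Mathlib only (the `nrm`-instance is the companion file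
`…NoZenoChartFibreClosed`).

THE SEAM.  In the slot-5 assembly one works with the chart resolution `σ : V ⟶ Spec N` of
`SurfaceTermination.ChartResolution.exists_chartMorphism`: `ρ : Z ⟶ Spec T` a resolution (proper),
`V = σ_B⁻¹(D₊(xt)) ⊆ Z` the preimage of the chart of `x ∈ I` under `σ_B : Z ⟶ Bl_I(Spec T)`,
`N ⊇ k[T ∪ I·x⁻¹]` (e.g. `N = nrm k[T ∪ I·x⁻¹]`), `σ` PROPER with `V.ι ≫ ρ = σ ≫ Spec (T → N)`.  For a
maximal `𝔮 ⊂ N` over a maximal ideal of `T` the assembly needs: every `z ∈ V` with `σ z = 𝔮` has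
`closure_Z {z} ⊆ V` — the curves of the fibre `σ⁻¹(𝔮)` do not leave the chart (used by UP-3-easy
and (A4) of B1-CENSUS-g8).

THE PROOF (elementary).
* §1 GENERAL FIBRE LEMMA: `U ⊆ Z` open, `ρ : Z ⟶ S` separated, `σ : U ⟶ Y` universally closed,
  `g : Y ⟶ S` with `U.ι ≫ ρ = σ ≫ g`, `i : W ⟶ Y` with `i ≫ g` universally closed ⇒ `U.ι(σ⁻¹(range i))`
  is CLOSED in `Z`: it is the range of `pullback.fst σ i ≫ U.ι` (`Scheme.Pullback.range_fst`), which
  followed by the separated `ρ` is the universally closed `pullback.snd ≫ i ≫ g`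
  (`UniversallyClosed.of_comp_of_isSeparated`).  Hence `closure_Z {z} ⊆ U` when `σ z ∈ range i`.
* §2 THE CLOSED POINT: `Y = Spec N`, `S = Spec T`, `𝔮 ⊂ N` maximal, `i = Spec (N → N/𝔮)` (range `{𝔮}`);
  `i ≫ g = Spec (T → N/𝔮)` is universally closed as soon as `T → N/𝔮` is INTEGRAL.
* §3 THE ALGEBRA (Zariski's lemma; no finiteness of normalisation needed): `N` integral over a
  finite-type `T`-algebra `C`, `𝔮 ∩ T` maximal ⇒ `T → N/𝔮` integral (`𝔮 ∩ C` is maximal, `C/(𝔮 ∩ C)` is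
  a field of finite type over the field `T/(𝔮 ∩ T)`, hence finite —
  `finite_of_finite_type_of_isJacobsonRing` — and `N/𝔮` is integral over it).
* §4 THE CHART: `k[T ∪ I·x⁻¹] ⊆ T[c₁x⁻¹, …, c_r x⁻¹]` for generators `cᵢ` of `I`, of finite type
  over `T`; `N` is assumed integral over `k[T ∪ I·x⁻¹]`.

References: The Stacks Project, Tags 01W6, 01WM, 00GB [`StacksProject`]; U. Görtz, T. Wedhorn,
*Algebraic Geometry I* (2020), Prop. 12.58, Cor. 12.89 [`GortzWedhorn2020`].
-/

noncomputable section

-- single-problem summit: the doubled namespace component `ResolutionOfSingularities` is forced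
set_option linter.dupNamespace false

namespace Summit.ResolutionOfSingularities.ResolutionOfSingularities.Theorems.NoZeno.ExcCount.ChartFibre

open CategoryTheory CategoryTheory.Limits AlgebraicGeometry TopologicalSpace Opposite

universe u

/-! ## §1 The general fibre lemma -/

section General

variable {Z S Y W : Scheme.{u}} (U : Z.Opens) (ρ : Z ⟶ S) (σ : (U : Scheme.{u}) ⟶ Y)
  (g : Y ⟶ S) (i : W ⟶ Y)

/-- **General fibre lemma.**  `U ⊆ Z` open, `ρ : Z ⟶ S` separated, `σ : U ⟶ Y` universally closed
over `S` (`U.ι ≫ ρ = σ ≫ g`), `i : W ⟶ Y` with `i ≫ g` universally closed: then `U.ι(σ⁻¹(range i))`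
is closed in `Z` — it is the range of the universally closed `pullback.fst σ i ≫ U.ι`.
[cite: StacksProject, Tag 01W6] -/
theorem isClosed_image_preimage_range [IsSeparated ρ] [UniversallyClosed σ]
    [UniversallyClosed (i ≫ g)] (hcomm : U.ι ≫ ρ = σ ≫ g) :
    IsClosed (U.ι '' (σ ⁻¹' Set.range i)) := by
  have h1 : UniversallyClosed ((pullback.fst σ i ≫ U.ι) ≫ ρ) := by
    rw [Category.assoc, hcomm, pullback.condition_assoc]
    infer_instance
  have h2 : UniversallyClosed (pullback.fst σ i ≫ U.ι) := .of_comp_of_isSeparated _ ρ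
  have h3 : IsClosed (Set.range (pullback.fst σ i ≫ U.ι)) :=
    (pullback.fst σ i ≫ U.ι).isClosedMap.isClosed_range
  have h4 : Set.range (pullback.fst σ i ≫ U.ι) = U.ι '' (σ ⁻¹' Set.range i) := by
    rw [← Scheme.Pullback.range_fst, ← Set.range_comp]
    rfl
  rwa [h4] at h3

/-- **Corollary: specialisations stay in `U`.**  Under the hypotheses of
`isClosed_image_preimage_range`, for `z ∈ U` with `σ z ∈ range i` the closure of `{z}` in `Z` lies
in `U` (indeed in `U.ι(σ⁻¹(range i))`). [cite: StacksProject, Tag 01W6] -/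
theorem closure_singleton_subset [IsSeparated ρ] [UniversallyClosed σ]
    [UniversallyClosed (i ≫ g)] (hcomm : U.ι ≫ ρ = σ ≫ g) (z : (U : Scheme.{u}))
    (hz : σ z ∈ Set.range i) :
    closure {U.ι z} ⊆ (U : Set Z) := by
  have hcl := isClosed_image_preimage_range U ρ σ g i hcomm
  have hsub : closure {U.ι z} ⊆ U.ι '' (σ ⁻¹' Set.range i) :=
    hcl.closure_subset_iff.mpr (Set.singleton_subset_iff.mpr ⟨z, hz, rfl⟩)
  refine hsub.trans ?_
  rintro _ ⟨z', -, rfl⟩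
  simpa only [← Scheme.Opens.range_ι] using Set.mem_range_self z'

/-- The closure version, pointwise: every specialisation in `Z` of such a `z` is a point of `U`
whose image under `σ` lies in `range i` as well. [cite: StacksProject, Tag 01W6] -/
theorem exists_eq_ι_of_mem_closure [IsSeparated ρ] [UniversallyClosed σ]
    [UniversallyClosed (i ≫ g)] (hcomm : U.ι ≫ ρ = σ ≫ g) (z : (U : Scheme.{u}))
    (hz : σ z ∈ Set.range i) {z' : Z} (hz' : z' ∈ closure {U.ι z}) :
    ∃ w : (U : Scheme.{u}), σ w ∈ Set.range i ∧ U.ι w = z' := by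
  have hcl := isClosed_image_preimage_range U ρ σ g i hcomm
  have hsub : closure {U.ι z} ⊆ U.ι '' (σ ⁻¹' Set.range i) :=
    hcl.closure_subset_iff.mpr (Set.singleton_subset_iff.mpr ⟨z, hz, rfl⟩)
  obtain ⟨w, hw, hwz⟩ := hsub hz'
  exact ⟨w, hw, hwz⟩

end General

/-! ## §2 The fibre over a closed point of an affine target -/

section Affine

variable {T N : Type u} [CommRing T] [CommRing N] (φ : T →+* N)

/-- The range of `Spec (N/𝔮) ⟶ Spec N` is `{𝔮}` for `𝔮` maximal. [folklore] -/
theorem range_specMap_quotient_mk (𝔮 : PrimeSpectrum N) [h𝔮 : 𝔮.asIdeal.IsMaximal] :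
    Set.range (Spec.map (CommRingCat.ofHom (Ideal.Quotient.mk 𝔮.asIdeal))) = {𝔮} := by
  have hfun : (fun p => Spec.map (CommRingCat.ofHom (Ideal.Quotient.mk 𝔮.asIdeal)) p) =
      PrimeSpectrum.comap (Ideal.Quotient.mk 𝔮.asIdeal) := by
    funext p
    rfl
  have hr : Set.range (Spec.map (CommRingCat.ofHom (Ideal.Quotient.mk 𝔮.asIdeal))) =
      Set.range (PrimeSpectrum.comap (Ideal.Quotient.mk 𝔮.asIdeal)) := congrArg Set.range hfun
  rw [hr, range_comap_of_surjective _ _ Ideal.Quotient.mk_surjective, Ideal.mk_ker,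
    ← PrimeSpectrum.closure_singleton]
  exact ((PrimeSpectrum.isClosed_singleton_iff_isMaximal 𝔮).mpr h𝔮).closure_eq

/-- `Spec (N/𝔮) ⟶ Spec N ⟶ Spec T` is universally closed when `T → N/𝔮` is integral (an integral
morphism is universally closed). [cite: StacksProject, Tag 01WM] -/
theorem universallyClosed_specMap_quotient_comp (𝔮 : Ideal N)
    (hint : ((Ideal.Quotient.mk 𝔮).comp φ).IsIntegral) :
    UniversallyClosed (Spec.map (CommRingCat.ofHom (Ideal.Quotient.mk 𝔮)) ≫
      Spec.map (CommRingCat.ofHom φ)) := by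
  rw [← Spec.map_comp, ← CommRingCat.ofHom_comp]
  haveI : IsIntegralHom (Spec.map (CommRingCat.ofHom ((Ideal.Quotient.mk 𝔮).comp φ))) :=
    IsIntegralHom.SpecMap_iff.mpr (by simpa only [CommRingCat.hom_ofHom] using hint)
  infer_instance

variable {Z : Scheme.{u}} (U : Z.Opens) (ρ : Z ⟶ Spec (.of T))
  (σ : (U : Scheme.{u}) ⟶ Spec (.of N))

/-- **The fibre over a closed point is closed in `Z`.**  `ρ : Z ⟶ Spec T` separated, `U ⊆ Z` open,
`σ : U ⟶ Spec N` universally closed with `U.ι ≫ ρ = σ ≫ Spec φ`, `𝔮 ⊂ N` maximal with `T → N/𝔮`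
integral: `U.ι(σ⁻¹{𝔮})` is closed in `Z`. [cite: StacksProject, Tag 01W6] -/
theorem isClosed_image_preimage_singleton [IsSeparated ρ] [UniversallyClosed σ]
    (hcomm : U.ι ≫ ρ = σ ≫ Spec.map (CommRingCat.ofHom φ)) (𝔮 : PrimeSpectrum N)
    [𝔮.asIdeal.IsMaximal] (hint : ((Ideal.Quotient.mk 𝔮.asIdeal).comp φ).IsIntegral) :
    IsClosed (U.ι '' (σ ⁻¹' {𝔮})) := by
  haveI := universallyClosed_specMap_quotient_comp φ 𝔮.asIdeal hint
  rw [← range_specMap_quotient_mk 𝔮]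
  exact isClosed_image_preimage_range U ρ σ (Spec.map (CommRingCat.ofHom φ))
    (Spec.map (CommRingCat.ofHom (Ideal.Quotient.mk 𝔮.asIdeal))) hcomm

/-- **Specialisations of fibre points stay in `U`** (closed-point form): with the hypotheses of
`isClosed_image_preimage_singleton`, every `z ∈ U` with `σ z = 𝔮` has `closure_Z {z} ⊆ U`.
[cite: StacksProject, Tag 01W6] -/
theorem closure_singleton_subset_of_isIntegral [IsSeparated ρ] [UniversallyClosed σ]
    (hcomm : U.ι ≫ ρ = σ ≫ Spec.map (CommRingCat.ofHom φ)) (𝔮 : PrimeSpectrum N)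
    [𝔮.asIdeal.IsMaximal] (hint : ((Ideal.Quotient.mk 𝔮.asIdeal).comp φ).IsIntegral)
    (z : (U : Scheme.{u})) (hz : σ z = 𝔮) :
    closure {U.ι z} ⊆ (U : Set Z) := by
  haveI := universallyClosed_specMap_quotient_comp φ 𝔮.asIdeal hint
  refine closure_singleton_subset U ρ σ (Spec.map (CommRingCat.ofHom φ))
    (Spec.map (CommRingCat.ofHom (Ideal.Quotient.mk 𝔮.asIdeal))) hcomm z ?_
  rw [range_specMap_quotient_mk 𝔮, hz]
  rfl

/-- Pointwise form: every specialisation in `Z` of a point of the fibre `σ⁻¹(𝔮)` is again a point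
of `U` in the fibre `σ⁻¹(𝔮)`. [cite: StacksProject, Tag 01W6] -/
theorem exists_eq_ι_of_mem_closure_of_isIntegral [IsSeparated ρ] [UniversallyClosed σ]
    (hcomm : U.ι ≫ ρ = σ ≫ Spec.map (CommRingCat.ofHom φ)) (𝔮 : PrimeSpectrum N)
    [𝔮.asIdeal.IsMaximal] (hint : ((Ideal.Quotient.mk 𝔮.asIdeal).comp φ).IsIntegral)
    (z : (U : Scheme.{u})) (hz : σ z = 𝔮) {z' : Z} (hz' : z' ∈ closure {U.ι z}) :
    ∃ w : (U : Scheme.{u}), σ w = 𝔮 ∧ U.ι w = z' := by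
  haveI := universallyClosed_specMap_quotient_comp φ 𝔮.asIdeal hint
  have hzr : σ z ∈ Set.range (Spec.map (CommRingCat.ofHom (Ideal.Quotient.mk 𝔮.asIdeal))) := by
    rw [range_specMap_quotient_mk 𝔮, hz]
    rfl
  obtain ⟨w, hw, hwz⟩ := exists_eq_ι_of_mem_closure U ρ σ (Spec.map (CommRingCat.ofHom φ))
    (Spec.map (CommRingCat.ofHom (Ideal.Quotient.mk 𝔮.asIdeal))) hcomm z hzr hz'
  rw [range_specMap_quotient_mk 𝔮] at hw
  exact ⟨w, hw, hwz⟩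

end Affine

/-! ## §3 The algebra: `T → N/𝔮` is integral (Zariski's lemma) -/

section Algebra

/-- **Integrality of the residue field over the base** (Zariski's lemma).  `C` a `T`-algebra of
finite type, `N` a `C`-algebra integral over `C`, `𝔮 ⊂ N` maximal with `𝔮 ∩ T` maximal: then `N/𝔮`
is integral over `T`.  (`𝔮 ∩ C` is maximal; `C/(𝔮 ∩ C)` is a field of finite type over the field
`T/(𝔮 ∩ T)`, hence finite; `N/𝔮` is integral over `C/(𝔮 ∩ C)`.) [cite: StacksProject, Tag 00GB] -/
theorem algebra_isIntegral_quotient (T C N : Type*) [CommRing T] [CommRing C] [CommRing N]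
    [Algebra T C] [Algebra C N] [Algebra T N] [IsScalarTower T C N] [Algebra.FiniteType T C]
    [Algebra.IsIntegral C N] (𝔮 : Ideal N) [𝔮.IsMaximal] [(𝔮.under T).IsMaximal] :
    Algebra.IsIntegral T (N ⧸ 𝔮) := by
  -- the intermediate prime `𝔭 = 𝔮 ∩ C` is maximal
  haveI : (𝔮.under C).IsMaximal := Ideal.IsMaximal.under C 𝔮
  -- the two residue fields
  letI : Field (T ⧸ 𝔮.under T) := Ideal.Quotient.field (𝔮.under T)
  letI : Field (C ⧸ 𝔮.under C) := Ideal.Quotient.field (𝔮.under C)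
  -- `𝔮 ∩ C` lies over `𝔮 ∩ T`
  haveI : (𝔮.under C).LiesOver (𝔮.under T) := inferInstance
  -- Zariski: the field `C/(𝔮 ∩ C)`, of finite type over the field `T/(𝔮 ∩ T)`, is finite over it
  haveI : Module.Finite (T ⧸ 𝔮.under T) (C ⧸ 𝔮.under C) :=
    finite_of_finite_type_of_isJacobsonRing (T ⧸ 𝔮.under T) (C ⧸ 𝔮.under C)
  haveI : Algebra.IsIntegral (T ⧸ 𝔮.under T) (C ⧸ 𝔮.under C) := inferInstance
  haveI : Algebra.IsIntegral T (T ⧸ 𝔮.under T) := inferInstance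
  haveI : Algebra.IsIntegral T (C ⧸ 𝔮.under C) :=
    Algebra.IsIntegral.trans (R := T) (A := T ⧸ 𝔮.under T) (B := C ⧸ 𝔮.under C)
  haveI : Algebra.IsIntegral (C ⧸ 𝔮.under C) (N ⧸ 𝔮) := inferInstance
  exact Algebra.IsIntegral.trans (R := T) (A := C ⧸ 𝔮.under C) (B := N ⧸ 𝔮)

/-- Ring-hom form of `algebra_isIntegral_quotient`: for `φ : T → C` of finite type, `ψ : C → N`
integral and `𝔮 ⊂ N` maximal with `(ψ ∘ φ)⁻¹ 𝔮` maximal, `T → N → N/𝔮` is integral.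
[cite: StacksProject, Tag 00GB] -/
theorem isIntegral_mk_comp_comp {T C N : Type*} [CommRing T] [CommRing C] [CommRing N]
    (φ : T →+* C) (ψ : C →+* N) (hφ : φ.FiniteType) (hψ : ψ.IsIntegral) (𝔮 : Ideal N)
    [𝔮.IsMaximal] (h𝔪 : (𝔮.comap (ψ.comp φ)).IsMaximal) :
    ((Ideal.Quotient.mk 𝔮).comp (ψ.comp φ)).IsIntegral := by
  algebraize [φ, ψ, ψ.comp φ]
  haveI : Algebra.IsIntegral C N := ⟨hψ⟩
  haveI : (𝔮.under T).IsMaximal := h𝔪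
  have h := algebra_isIntegral_quotient T C N 𝔮
  rw [Algebra.isIntegral_def] at h
  intro y
  exact h y

end Algebra

/-! ## §4 The chart -/

section Subalgebras

variable {k K : Type} [Field k] [Field K] [Algebra k K]

/-- **Subalgebra form of §3.**  `T ≤ N` subalgebras of `K`, `F ⊆ N` finite, every element of `N`
integral over `T[F]`, `𝔮 ⊂ N` maximal lying over a maximal ideal of `T`: `T → N/𝔮` is integral.
[cite: StacksProject, Tag 00GB] -/
theorem isIntegral_mk_comp_inclusion (T N : Subalgebra k K) (hTN : T ≤ N) (F : Finset K)
    (hFN : (F : Set K) ⊆ N) (hint : ∀ y ∈ N, IsIntegral ↥(Algebra.adjoin (↥T) (F : Set K)) y)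
    (𝔮 : Ideal ↥N) [𝔮.IsMaximal]
    (h𝔪 : (𝔮.comap (Subalgebra.inclusion hTN).toRingHom).IsMaximal) :
    ((Ideal.Quotient.mk 𝔮).comp (Subalgebra.inclusion hTN).toRingHom).IsIntegral := by
  -- the finite-type intermediate ring `C = T[F]`, which lies in `N`
  have hCN : ∀ y : ↥(Algebra.adjoin (↥T) (F : Set K)), (y : K) ∈ N := by
    intro y
    -- `N` as a `T`-subalgebra of `K`
    let N' : Subalgebra (↥T) K :=
      { carrier := N
        mul_mem' := fun ha hb => N.mul_mem ha hb
        one_mem' := N.one_mem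
        add_mem' := fun ha hb => N.add_mem ha hb
        zero_mem' := N.zero_mem
        algebraMap_mem' := fun t => hTN t.2 }
    have hle : Algebra.adjoin (↥T) (F : Set K) ≤ N' := Algebra.adjoin_le hFN
    exact hle y.2
  -- the two ring maps `φ : T → C`, `ψ : C → N`
  let φ : ↥T →+* ↥(Algebra.adjoin (↥T) (F : Set K)) := algebraMap _ _
  let ψ : ↥(Algebra.adjoin (↥T) (F : Set K)) →+* ↥N :=
    (algebraMap ↥(Algebra.adjoin (↥T) (F : Set K)) K).codRestrict N hCN
  have hcomp : ψ.comp φ = (Subalgebra.inclusion hTN).toRingHom := RingHom.ext fun t => Subtype.ext rfl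
  -- `φ` is of finite type
  haveI : Algebra.FiniteType ↥T ↥(Algebra.adjoin (↥T) (F : Set K)) :=
    (Subalgebra.fg_iff_finiteType _).mp (Subalgebra.fg_adjoin_finset _)
  have hφ : φ.FiniteType := RingHom.finiteType_algebraMap.mpr inferInstance
  -- `ψ` is integral: an integral equation over `C` in `K` is one in `N`
  have hψ : ψ.IsIntegral := by
    intro n
    obtain ⟨p, hp, hpn⟩ := hint (n : K) n.2
    refine ⟨p, hp, Subtype.ext ?_⟩
    have hval : ((algebraMap ↥N K).comp ψ) = algebraMap ↥(Algebra.adjoin (↥T) (F : Set K)) K :=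
      RingHom.ext fun _ => rfl
    have h := Polynomial.hom_eval₂ p ψ (algebraMap ↥N K) n
    rw [hval] at h
    change (algebraMap ↥N K) (Polynomial.eval₂ ψ n p) = ((0 : ↥N) : K)
    rw [h, ZeroMemClass.coe_zero]
    exact hpn
  have h𝔪' : (𝔮.comap (ψ.comp φ)).IsMaximal := by rwa [hcomp]
  have h := isIntegral_mk_comp_comp φ ψ hφ hψ 𝔮 h𝔪'
  rwa [hcomp] at h

variable (T : Subalgebra k K) {I : Ideal ↥T} {x : ↥T}

/-- **The chart ring is of finite type, so §3 applies.**  `N ⊆ K` a `k`-subalgebra containing `T`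
and `I·x⁻¹` and integral over the chart ring `k[T ∪ I·x⁻¹]`, `I` finitely generated, `𝔮 ⊂ N` maximal
over a maximal ideal of `T`: `T → N/𝔮` is integral.  (With generators `c₁, …, c_r` of `I`:
`k[T ∪ I·x⁻¹] ⊆ T[c₁x⁻¹, …, c_r x⁻¹]`, of finite type over `T`.) [cite: StacksProject, Tag 00GB] -/
theorem isIntegral_mk_comp_inclusion_chart (hI : I.FG) (N : Subalgebra k K) (hTN : T ≤ N)
    (hIN : ∀ c : ↥T, c ∈ I → (c : K) * (x : K)⁻¹ ∈ N)
    (hNint : ∀ y ∈ N, IsIntegral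
      ↥(Algebra.adjoin k ((T : Set K) ∪ {y : K | ∃ c : ↥T, c ∈ I ∧ y = (c : K) * (x : K)⁻¹})) y)
    (𝔮 : Ideal ↥N) [𝔮.IsMaximal]
    (h𝔪 : (𝔮.comap (Subalgebra.inclusion hTN).toRingHom).IsMaximal) :
    ((Ideal.Quotient.mk 𝔮).comp (Subalgebra.inclusion hTN).toRingHom).IsIntegral := by
  classical
  -- generators `c₁, …, c_r` of `I` and the finite set `F = {cᵢ · x⁻¹}`
  obtain ⟨s, hs⟩ := hI
  let F : Finset K := s.image fun c : ↥T => (c : K) * (x : K)⁻¹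
  have hFN : (F : Set K) ⊆ N := by
    intro y hy
    obtain ⟨c, hc, rfl⟩ := Finset.mem_image.mp (Finset.mem_coe.mp hy)
    exact hIN c (hs ▸ Ideal.subset_span hc)
  -- the chart ring `k[T ∪ I·x⁻¹]` lies in `T[F]` (as subsets of `K`)
  have hCF : (Algebra.adjoin k ((T : Set K) ∪ {y : K | ∃ c : ↥T, c ∈ I ∧ y = (c : K) * (x : K)⁻¹}) :
      Set K) ⊆ Algebra.adjoin (↥T) (F : Set K) := by
    change Algebra.adjoin k _ ≤ (Algebra.adjoin (↥T) (F : Set K)).restrictScalars k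
    refine Algebra.adjoin_le ?_
    rintro y (hy | ⟨c, hc, rfl⟩)
    · exact Subalgebra.algebraMap_mem (Algebra.adjoin (↥T) (F : Set K)) (⟨y, hy⟩ : ↥T)
    · -- `c = Σ tᵢ cᵢ` with `cᵢ ∈ s`, so `c · x⁻¹ = Σ tᵢ (cᵢ · x⁻¹) ∈ T[F]`
      change (c : K) * (x : K)⁻¹ ∈ Algebra.adjoin (↥T) (F : Set K)
      rw [← hs] at hc
      refine Submodule.span_induction
        (p := fun (c : ↥T) _ => (c : K) * (x : K)⁻¹ ∈ Algebra.adjoin (↥T) (F : Set K)) ?_ ?_ ?_ ?_ hc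
      · intro c hc
        exact Algebra.subset_adjoin (Finset.mem_coe.mpr (Finset.mem_image.mpr ⟨c, hc, rfl⟩))
      · simp only [ZeroMemClass.coe_zero, zero_mul]
        exact Subalgebra.zero_mem _
      · intro a b _ _ ha hb
        rw [AddMemClass.coe_add, add_mul]
        exact Subalgebra.add_mem _ ha hb
      · intro t a _ ha
        rw [smul_eq_mul, MulMemClass.coe_mul, mul_assoc]
        exact Subalgebra.mul_mem _ (Subalgebra.algebraMap_mem _ t) ha
  -- so `N` is integral over `T[F]`
  have hint : ∀ y ∈ N, IsIntegral ↥(Algebra.adjoin (↥T) (F : Set K)) y := by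
    intro y hy
    obtain ⟨p, hp, hpy⟩ := hNint y hy
    let ι : ↥(Algebra.adjoin k ((T : Set K) ∪ {y : K | ∃ c : ↥T, c ∈ I ∧ y = (c : K) * (x : K)⁻¹})) →+*
        ↥(Algebra.adjoin (↥T) (F : Set K)) :=
      (algebraMap _ K).codRestrict (Algebra.adjoin (↥T) (F : Set K)) fun a => hCF a.2
    refine ⟨p.map ι, hp.map ι, ?_⟩
    have hcomp : (algebraMap ↥(Algebra.adjoin (↥T) (F : Set K)) K).comp ι =
        algebraMap ↥(Algebra.adjoin k ((T : Set K) ∪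
          {y : K | ∃ c : ↥T, c ∈ I ∧ y = (c : K) * (x : K)⁻¹})) K := RingHom.ext fun _ => rfl
    rw [Polynomial.eval₂_map, hcomp]
    exact hpy
  exact isIntegral_mk_comp_inclusion T N hTN F hFN hint 𝔮 h𝔪

variable {Z : Scheme.{0}} (U : Z.Opens) (ρ : Z ⟶ Spec (.of ↥T))

/-- **(A2) «C-curves lie in the chart».**  Let `ρ : Z ⟶ Spec T` be separated (e.g. a resolution),
`U ⊆ Z` open (the preimage `σ_B⁻¹(D₊(xt))` of the chart of `x ∈ I`), `N ⊆ K` a `k`-subalgebra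
containing `T` and `I·x⁻¹` and INTEGRAL over the chart ring `k[T ∪ I·x⁻¹]` (e.g. `N = nrm k[T ∪ I·x⁻¹]`,
companion file `…NoZenoChartFibreClosed`), `I` finitely generated, and `σ : U ⟶ Spec N` universally
closed (e.g. the proper chart morphism of `SurfaceTermination.ChartResolution.exists_chartMorphism`)
with `U.ι ≫ ρ = σ ≫ Spec (T → N)`.  Then for every maximal `𝔮 ⊂ N` lying over a maximal ideal of `T`
and every `z ∈ U` with `σ z = 𝔮`: `closure_Z {z} ⊆ U` — the curves of the fibre `σ⁻¹(𝔮)` do not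
leave the chart. [cite: StacksProject, Tag 01W6; StacksProject, Tag 00GB] -/
theorem closure_subset_preimage_chart [IsSeparated ρ] (hI : I.FG) (N : Subalgebra k K)
    (hTN : T ≤ N) (hIN : ∀ c : ↥T, c ∈ I → (c : K) * (x : K)⁻¹ ∈ N)
    (hNint : ∀ y ∈ N, IsIntegral
      ↥(Algebra.adjoin k ((T : Set K) ∪ {y : K | ∃ c : ↥T, c ∈ I ∧ y = (c : K) * (x : K)⁻¹})) y)
    (σ : (U : Scheme.{0}) ⟶ Spec (.of ↥N)) [UniversallyClosed σ]
    (hσ : U.ι ≫ ρ = σ ≫ Spec.map (CommRingCat.ofHom (Subalgebra.inclusion hTN).toRingHom))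
    (𝔮 : PrimeSpectrum ↥N) [𝔮.asIdeal.IsMaximal]
    (h𝔪 : (𝔮.asIdeal.comap (Subalgebra.inclusion hTN).toRingHom).IsMaximal)
    (z : (U : Scheme.{0})) (hz : σ z = 𝔮) :
    closure {U.ι z} ⊆ (U : Set Z) :=
  closure_singleton_subset_of_isIntegral (Subalgebra.inclusion hTN).toRingHom U ρ σ hσ 𝔮
    (isIntegral_mk_comp_inclusion_chart T hI N hTN hIN hNint 𝔮.asIdeal h𝔪) z hz

/-- Pointwise form of `closure_subset_preimage_chart`: every specialisation in `Z` of a point of the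
fibre `σ⁻¹(𝔮)` is a point of `U`, again in the fibre. [cite: StacksProject, Tag 01W6] -/
theorem exists_eq_ι_of_mem_closure_chart [IsSeparated ρ] (hI : I.FG) (N : Subalgebra k K)
    (hTN : T ≤ N) (hIN : ∀ c : ↥T, c ∈ I → (c : K) * (x : K)⁻¹ ∈ N)
    (hNint : ∀ y ∈ N, IsIntegral
      ↥(Algebra.adjoin k ((T : Set K) ∪ {y : K | ∃ c : ↥T, c ∈ I ∧ y = (c : K) * (x : K)⁻¹})) y)
    (σ : (U : Scheme.{0}) ⟶ Spec (.of ↥N)) [UniversallyClosed σ]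
    (hσ : U.ι ≫ ρ = σ ≫ Spec.map (CommRingCat.ofHom (Subalgebra.inclusion hTN).toRingHom))
    (𝔮 : PrimeSpectrum ↥N) [𝔮.asIdeal.IsMaximal]
    (h𝔪 : (𝔮.asIdeal.comap (Subalgebra.inclusion hTN).toRingHom).IsMaximal)
    (z : (U : Scheme.{0})) (hz : σ z = 𝔮) {z' : Z} (hz' : z' ∈ closure {U.ι z}) :
    ∃ w : (U : Scheme.{0}), σ w = 𝔮 ∧ U.ι w = z' :=
  exists_eq_ι_of_mem_closure_of_isIntegral (Subalgebra.inclusion hTN).toRingHom U ρ σ hσ 𝔮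
    (isIntegral_mk_comp_inclusion_chart T hI N hTN hIN hNint 𝔮.asIdeal h𝔪) z hz hz'

end Subalgebras

end Summit.ResolutionOfSingularities.ResolutionOfSingularities.Theorems.NoZeno.ExcCount.ChartFibre

end
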